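import Literature.NumberTheory.Kottwitz1986.LocalCohomology
import Literature.NumberTheory.Kottwitz1986.GlobalCohomology
import Mathlib.Algebra.Field.Defs
import Mathlib.Algebra.Group.Units.Defs
import Mathlib.Data.Complex.Basic
import Mathlib.Data.Set.Function
import Mathlib.Data.Set.Finite.Basic
import HarnessLib

/-!
# Kottwitz 1986, §3 «(G, H)-regular elements in an endoscopic group `H` for `G`» (3.1, Lemma 3.2) and §4 «Definitions
# of 𝔇, 𝔈, 𝔎» (4.1–4.6, Lemma 4.3) — the root-datum DEFINITION of `(G, H)`-regularity with a body, and the printed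
# statements as a LETTER over posited data (nothing asserted)

R. E. Kottwitz, *Stable trace formula: elliptic singular terms*, Math. Ann. **275** (1986) 365–399 [Kottwitz1986], §3
pp. 377–378 and §4 pp. 378–379.  Source text: the open GDZ digitisation (Göttingen, PPN235181684_0275 LOG_0056, store key
`paper:url-ecbc59a1db27`; canvas = printed page + 6): publisher OCR per page in the cell at
`run/shared/lean/pub/hodgecm-mathlib/lit/lit3/g0/texts/Kottwitz1986-GDZ/p0377.txt … p0379.txt`, every formula READ on the page
images `…/T/KOT/TK-t11/g0/img/p0377.jpg … p0379.jpg` (the publisher's text is paywalled, acq-14999; the GDZ scan is page-exact).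
Squad TK (HCML «GO 500»), typer TK-t11; target `Literature/NumberTheory/Kottwitz1986/RegularAndSigns.lean`, namespace
`Literature.NumberTheory.Kottwitz1986.RegularAndSigns`.  STATEMENTS ONLY (cell TYPER LINT RULE): definitions with bodies where
the print DEFINES something combinatorial (`IsGHRegular`, `IsGRegular`, `rootsOfCentralizer`, the sets `𝔇`, `𝔈`, `𝔈(I/𝔸)`, `𝔎`),
posited data for the ambient objects Mathlib lacks (reductive groups, maximal tori, `H¹`, dual groups), and `Prop`-valued
relations (one `def` per printed statement, verbatim numbering `Kottwitz1986_<n>_<m>_…`); no theorem, no proof, no `sorry`,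
no `axiom`, no `instance`, no `notation`.  The §1 objects `H¹(F, ·)`, `A(·) = π₀(Z(·̂)^Γ)^D`, `α` (Theorem 1.2) and the §2
objects `H¹(F, ·)`, the places `v` are IMPORTED from the sibling carpets ★ `LocalCohomology.LocalDatum` (t01, p847873) and
★ `GlobalCohomology.GlobalDatum` (t01, p847878) — the §4 data below are parametrised by those data, not re-posited.  ED. 2 (same
day, squad QA T-ref5 «QA-11» NB-1∕NB-2): 4.4 records that `A(I) → A(G)` respects unit and product («finite abelian GROUP»), and the 4.6
docstring says in which variable the posited pairing is multiplicative; nothing else changed.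

## Source, verbatim (formulas from the page images)

**§3** (p. 377) «In this section `F` is a local or global field of characteristic 0, `G` is a connected reductive group over
`F`, and `(H, s, η)` is an endoscopic triple for `G` [K3, Sect. 7].  **3.1.** For the moment we work over `F̄`. Let `γ_H` be a
semi-simple element of `H`. Choose a maximal torus `T_H` of `H` containing `γ_H`. There is a canonical `G`-conjugacy class of
embeddings `j : T_H → G`; choose one and let `γ = j(γ_H)`. The conjugacy class of `γ` is independent of the choice of `T_H` and
`j`; thus `γ_H ↦ γ` induces a `Γ`-equivariant map» (p. 378) «from the set of semi-simple conjugacy classes in `H` to the set of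
semi-simple conjugacy classes in `G`.  Let `T = j(T_H)` and use `j` to identify `T_H`, `T`. Let `R` (respectively `R_H`) denote
the set of roots of `T` in `G` (respectively `H`). We have `R_H ⊂ R ⊂ X^*(T)`. We say that `γ_H` is `(G, H)`-regular if
`α(γ_H) ≠ 1` for every root `α` of `G` that does not come from a root of `H`. The `(G, H)`-regularity of `γ_H` depends only on
`γ_H`, not on the choice of `T_H` and `j`.  Let `I` (respectively `I_H`) denote the identity component of the centralizer of `γ`
in `G` (respectively, `γ_H` in `H`). The set `R(γ)` of roots of `T` in `I` is equal to `{α ∈ R | α(γ) = 1}`. The set `R_H(γ)` of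
roots of `T` in `I_H` is equal to `{α ∈ R_H | α(γ) = 1}`. Therefore `R_H(γ) ⊂ R(γ)` and the two sets are equal if and only if
`γ_H` is `(G, H)`-regular.  Now assume that `γ_H` is `(G, H)`-regular. Then `R_H(γ) = R(γ)` and the same is true for the coroots
of `T` in `I_H`, `I`. The theory of root data for reductive groups shows that `j : T_H ⥲ T` extends to an isomorphism
`j₁ : I_H → I`, unique up to inner automorphisms coming from `T`. If `γ_H ∈ H(F)` and `γ ∈ G(F)`, then `I_H`, `I` are defined
over `F` and `j₁` is an inner twisting. In particular we have `Z(Î_H) = Z(Î)`.  **3.2. Lemma.** Let `γ_H, γ` be as above and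
assume that `γ_H` is `(G, H)`-regular. If the centralizer of `γ` in `G` is connected, then so is the centralizer of `γ_H` in
`H`.» (Proof, p. 378: Weyl groups, `Ω(T, I) = Ω(T_H, I_H)` by `(G, H)`-regularity.)

**§4** (p. 378) «In this section `F` is a local or global field of characteristic 0 and `G` is a connected reductive group over
`F`. Let `γ` be a semi-simple element of `G(F)`, and let `I` denote the identity component of `G_γ`. As before we write `A(G)`
instead of `π₀(Z(Ĝ)^Γ)^D`.  **4.1.** We define `𝔇(I/F)` to be `ker[H¹(F, I) → H¹(F, G)]`. If `G_γ` is connected, then `𝔇(I/F)`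
is in 1–1 correspondence with the conjugacy classes in the stable conjugacy class of `γ`. The 1–1 correspondence arises as
follows. Let `γ′ ∈ G(F)` be a stable conjugate of `γ`. Then `{g ∈ G(F̄) | gγg⁻¹ = γ′}` is an `F`-torsor under `I`.  **4.2.** There
is a canonical `Γ`-equivariant injection of `Z(Ĝ)` into `Z(Î)`. To construct it we choose a maximal `F`-torus `T` of `I`. Then
`T` is also a maximal `F`-torus of `G`. We can regard `Z(Ĝ)`, `Z(Î)` as subgroups of `T̂`. It is easy to see that `Z(Ĝ) ⊂ Z(Î)`
and that this injection does not depend on the choice of `T`.  **4.3. Lemma.** Assume that `F` is local. Then the diagram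
`H¹(F, I) → H¹(F, G)` ∕ `A(I) → A(G)` commutes, where the bottom arrow is induced by the injection `Z(Ĝ) → Z(Î)` of 4.2.»
(p. 379: «Since `I → G` is not a normal homomorphism, we cannot apply the functoriality of `H¹(F, G) → A(G)` directly. … The
lemma follows from the surjectivity of `H¹(F, T) → H¹(F, I)` (see Sect. 10) and the second statement of Theorem 1.2.»)
«**4.4.** Assume that `F` is local. We define `𝔈(I/F)` to be the finite abelian group `ker[A(I) → A(G)]`. Lemma 4.3 gives us a
canonical map `𝔇(I/F) → 𝔈(I/F)`, which is bijective in the `p`-adic case.  **4.5.** Assume that `F` is global. We define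
`𝔈(I/𝔸)` to be `⊕_v 𝔈(I/F_v)`, where `v` runs through the set of places of `F`.  **4.6.** The exact sequence
`1 → Z(Ĝ) → Z(Î) → Z(Î)/Z(Ĝ) → 1` gives us a homomorphism [K3, Corollary 2.3] `π₀([Z(Î)/Z(Ĝ)]^Γ) → H¹(F, Z(Ĝ))`. We define
`𝔎(I/F)` to be the subgroup of `π₀([Z(Î)/Z(Ĝ)]^Γ)` consisting of all elements whose image in `H¹(F, Z(Ĝ))` is (a) trivial if
`F` is local, (b) locally trivial if `F` is global. If `F` is local, then `𝔎(I/F) = cok[A(G)^D → A(I)^D] = 𝔈(I/F)^D`.»  (p. 381,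
§5.6: «`⟨·, ·⟩` denotes the duality pairing between `𝔈(I/F)` and `𝔎(I/F)` (see 4.6)» — the pairing posited below.)

## What is typed, and how

* §1 (Mathlib level, bodies): for a set `R` of roots in a character lattice `X`, the subset `R_H` of roots coming from `H`, and
  the evaluation `ev : X → M` at an element (`α ↦ α(γ_H)`, `M = F̄ˣ`): **`IsGHRegular R R_H ev`** (the printed definition),
  **`IsGRegular R ev`** («`G`-regular»: `α(γ) ≠ 1` for all roots), **`rootsOfCentralizer R ev`** `= R(γ) = {α ∈ R | α(γ) = 1}`;
  the printed remark «`R_H(γ) ⊂ R(γ)`, with equality iff `(G, H)`-regular» is a one-line consequence of these two definitions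
  and is not typed as a fact; and **`IsTorsorClassification`**, the shape of the 1–1 correspondence of 4.1 for abstract data.
* §2 `EndoscopicDatum F̄` — the §3 data AS A DATUM (parameter: the algebraic closure `F̄` as a field, root values in `F̄ˣ`):
  `Γ`, the points `H(F̄)`, `G(F̄)` with `Γ`-actions, semisimplicity, conjugacy and rationality predicates; the maximal tori
  `T_H` of `H` with «`γ_H ∈ T_H`», the character lattice `X^*(T_H)` (`= X^*(T)` via `j`), the root sets `R ⊃ R_H` transported
  to it, the evaluation `α ↦ α(γ_H)`; the members `j` of the canonical `G`-conjugacy class of embeddings `T_H → G` with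
  `γ_H ↦ j(γ_H)`; «the centralizer is connected» in `G` and in `H`; the isomorphisms `j₁ : I_H → I` with «extends `j`»,
  «differ by an inner automorphism coming from `T`», «is an inner twisting», and the transport `Z(Î_H) → Z(Î)` along `j₁`.
  RELATIONS: `SemisimpleInTorus`, `EmbNonempty`, `RootsNested`, `IsGHRegularAt ∕ IsGRegularAt ∕ IsGHRegularElem` (bodies,
  through §1), **`Kottwitz1986_3_1_imageWellDefined`**, **`Kottwitz1986_3_1_classMap`** (the `Γ`-equivariant map on semisimple
  classes), **`Kottwitz1986_3_1_regularWellDefined`**, **`Kottwitz1986_3_1_centralizerIso`** (`j₁` exists, unique up to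
  `Int(T)`), **`Kottwitz1986_3_1_innerTwisting`** (rational case; `Z(Î_H) = Z(Î)` canonically), **`Kottwitz1986_3_2`** (LEMMA 3.2).
* §3 `LocalSignsDatum L` over ★ `LocalCohomology.LocalDatum` `L` (`F` LOCAL; reused by name: `L.Grp`, `L.H1`, `L.base`, `L.A`,
  `L.oneA`, `L.mulA`, `L.alpha`, `L.IsPadic`): `G(F)`, semisimple, `I = (G_γ)⁰` as an object `cent γ : L.Grp`, «`G_γ` connected»,
  stable conjugacy and `G(F)`-conjugacy, the map `H¹(F, I) → H¹(F, G)` (NOT a normal homomorphism, hence not `L.H1map`), the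
  torsor class `inv(γ, γ′) ∈ H¹(F, I)` of 4.1, `Z(Ĝ)` with its `Γ`-action and the injection of 4.2, `A(I) → A(G)` induced by it,
  `π₀([Z(Î)/Z(Ĝ)]^Γ) → H¹(F, Z(Ĝ))` of 4.6 and the duality pairing `⟨·, ·⟩`.  DEFINED: **`frakD`** `= 𝔇(I/F)`, **`frakE`**
  `= 𝔈(I/F)`, **`frakK`** `= 𝔎(I/F)` (sets cut out by the printed conditions), `dToE` (the map of 4.4).  RELATIONS:
  **`Kottwitz1986_4_1`**, **`Kottwitz1986_4_2`**, **`Kottwitz1986_4_3`** (LEMMA 4.3), **`Kottwitz1986_4_4`**, **`Kottwitz1986_4_6_local`**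
  (`𝔎(I/F) = 𝔈(I/F)^D` as a perfect pairing; the intermediate «`= cok[A(G)^D → A(I)^D]`» is the [K3, 2.3] exactness and is
  recorded in words).
* §4 `GlobalSignsDatum M` over ★ `GlobalCohomology.GlobalDatum` `M` (`F` GLOBAL; reused: `M.Grp`, `M.H1F`, `M.Pl`): the same
  4.1 objects for `H¹(F, ·)`, the local groups `𝔈(I/F_v)` with their units, the 4.6 map and its localisations
  `H¹(F, Z(Ĝ)) → H¹(F_v, Z(Ĝ))`.  DEFINED: **`frakD`**, **`frakEA`** `= 𝔈(I/𝔸) = ⊕_v 𝔈(I/F_v)` (finitely supported families),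
  **`frakK`** `= 𝔎(I/F)` (locally trivial image).  RELATION: **`Kottwitz1986_4_1`** (global case).
NOT typed: the proofs (Weyl-group argument of 3.2; elliptic ∕ fundamental tori and §10 for 4.3), the endoscopic triple
`(H, s, η)` itself and [K3] = Kottwitz, *Stable trace formula: cuspidal tempered terms*, Duke Math. J. 51 (1984) (cited by the
source for `𝔎`, not restated), the local conjectures of §5 (sibling carpet `LocalConjectures`).

DEDUP (2026-09-02, `rg` ∕ `lean search` by content): cite tags «Kottwitz1986, §3» = 1022 in 240 tree files, all secondary
co-citations on `U(3)` ∕ `GL_n` transfer rows under `Literature/NumberTheory/Automorphic/` and `…/Rogawski1990/` (no general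
statement); tags for Lemma 3.2, §4, 4.x = 0.  `(G, H)`-regular exists only as posited predicates (★ `Stabilization.StabilizationData
.IsGHRegular`, ★ `LocalFiniteness.LocalFinitenessData.SSHreg`) and the concrete ★ `Rogawski1990.SplitPlaceTwistedTransfer.IsGHRegularSplit`
(`GL₂ × GL₁`) — no general definition before this file; `𝔇 ∕ 𝔈 ∕ 𝔎` have no tree carrier (`kerOne` is the `U(3)` `ker¹`;
★ `Kottwitz1992.KottwitzTriples` posits `𝔎(I₀/ℚ)^D` bare).  Mathlib has no reductive groups over local fields, no Langlands dual,
no `H¹(F, G)` for algebraic `G` — hence the posited data (squad ruling V1).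

## References
* [Kottwitz1986] R. E. Kottwitz, Stable trace formula: elliptic singular terms, Math. Ann. 275 (1986) 365–399: §3 (3.1 pp. 377–378,
  Lemma 3.2 p. 378), §4 (4.1–4.3 p. 378, proof of 4.3 and 4.4–4.6 p. 379), §5.6 p. 381 (the pairing).
-/

namespace Literature.NumberTheory.Kottwitz1986.RegularAndSigns

universe u v

/-! ## §1 `(G, H)`-regularity and `R(γ)` at the level of root data (definitions with bodies) -/

section RootData

variable {X : Type u} {M : Type v} [One M]

/-- **`R(γ) = {α ∈ R | α(γ) = 1}`** — the roots (among `R`) of `T` in the connected centralizer `I` of `γ`, for `ev = (α ↦ α(γ))`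
the evaluation of characters at `γ` (p. 378: «The set `R(γ)` of roots of `T` in `I` is equal to `{α ∈ R | α(γ) = 1}`»; with
`R_H` in place of `R` this is `R_H(γ)`). [cite: Kottwitz1986, §3.1 (p. 378)] -/
def rootsOfCentralizer (R : Set X) (ev : X → M) : Set X :=
  {α | α ∈ R ∧ ev α = 1}

/-- **`(G, H)`-regular** (the printed definition, p. 378): «We say that `γ_H` is `(G, H)`-regular if `α(γ_H) ≠ 1` for every
root `α` of `G` that does not come from a root of `H`» — for the set `R` of roots of `T = j(T_H)` in `G`, the subset `R_H ⊂ R`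
of roots of `H` (identified through `j`), and the evaluation `ev = (α ↦ α(γ_H))`.  The printed remark «`R_H(γ) ⊂ R(γ)` and the
two sets are equal if and only if `γ_H` is `(G, H)`-regular» is immediate from this definition and `rootsOfCentralizer` (for
`R_H ⊆ R`) and is not typed as a separate fact. [cite: Kottwitz1986, §3.1 (p. 378)] -/
def IsGHRegular (R RH : Set X) (ev : X → M) : Prop :=
  ∀ ⦃α : X⦄, α ∈ R → α ∉ RH → ev α ≠ 1

/-- **`G`-regular** (the case `R_H = ∅` of `IsGHRegular`, used in §5.4 and §5.6: «`G`-regular semi-simple element `γ_H`»):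
`α(γ) ≠ 1` for every root `α` of `G`, i.e. `R(γ) = ∅`, the connected centralizer is the torus `T`. [cite: Kottwitz1986, §3.1 (p. 378), §5.6 (p. 380)] -/
def IsGRegular (R : Set X) (ev : X → M) : Prop :=
  ∀ ⦃α : X⦄, α ∈ R → ev α ≠ 1

end RootData

/-- **The shape of the 1–1 correspondence of 4.1** for abstract data: a map of pointed sets `ι : H¹(F, I) → H¹(F, G)` (base
point `b`), the stable conjugates `s : S` of `γ` with `G(F)`-conjugacy `conj`, and `inv s ∈ H¹(F, I)` the class of the
`I`-torsor `{g ∈ G(F̄) | gγg⁻¹ = γ′}`: every `inv s` lies in `𝔇(I/F) = ι⁻¹(b)`, two stable conjugates have the same class iff they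
are conjugate, and every element of `𝔇(I/F)` is some `inv s` — «`𝔇(I/F)` is in 1–1 correspondence with the conjugacy classes
in the stable conjugacy class of `γ`». [cite: Kottwitz1986, §4.1 (p. 378)] -/
def IsTorsorClassification {S : Type u} {H1I H1G : Type v} (ι : H1I → H1G) (b : H1G) (conj : S → S → Prop)
    (inv : S → H1I) : Prop :=
  (∀ s : S, ι (inv s) = b) ∧ (∀ s s' : S, inv s = inv s' ↔ conj s s') ∧ ∀ x : H1I, ι x = b → ∃ s : S, inv s = x

/-! ## §2 The data of §3 AS A DATUM, and 3.1 ∕ Lemma 3.2 as relations over it -/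

/-- **The data of Kottwitz's §3 AS A DATUM.**  Behind it (not fields): the field `F` (local or global, characteristic 0), the
connected reductive `F`-group `G` and the endoscopic triple `(H, s, η)` [K3, Sect. 7] (p. 377).  PARAMETER: the algebraic
closure `F̄` as a field (root values `α(γ_H) ∈ F̄ˣ`).  Fields: `Γ = Gal(F̄/F)` acting on the points `H(F̄)`, `G(F̄)`; «semi-simple»,
conjugacy (under `H(F̄)`, `G(F̄)`) and rationality («`γ_H ∈ H(F)`», «`γ ∈ G(F)`») predicates; the maximal tori `T_H` of `H` with
membership «`γ_H ∈ T_H`»; the character lattice `X^*(T_H)`, identified with `X^*(T)` by `j`, carrying the root sets `R` (of `T` in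
`G`) and `R_H` (of `T_H` in `H`) and the evaluation `α ↦ α(γ_H)`; the members `j` of «the canonical `G`-conjugacy class of embeddings
`j : T_H → G`» acting on the elements of `T_H`; «the centralizer of `γ` in `G` is connected», «the centralizer of `γ_H` in `H` is
connected»; the isomorphisms `j₁ : I_H → I` between the connected centralizers with the predicates «extends `j : T_H ⥲ T`»,
«differ by an inner automorphism coming from `T`», «is an inner twisting», and the map `Z(Î_H) → Z(Î)` transported along `j₁`.
No field asserts a printed statement. [cite: Kottwitz1986, §3 (pp. 377–378)] -/
structure EndoscopicDatum (Fbar : Type u) [Field Fbar] : Type (u + 1) where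
  /-- `Γ = Gal(F̄/F)` [p. 368 «we write `Γ` for `Gal(F̄/F)`»; §3.1 p. 377 «`Γ`-equivariant»] -/
  Gal : Type u
  /-- the points `H(F̄)` of the endoscopic group (where the semi-simple `γ_H` live, «we work over `F̄`») [§3.1 p. 377] -/
  HB : Type u
  /-- the points `G(F̄)` [§3.1 p. 377] -/
  GB : Type u
  /-- the action of `Γ` on `H(F̄)` [§3.1 p. 377] -/
  galH : Gal → HB → HB
  /-- the action of `Γ` on `G(F̄)` [§3.1 p. 377] -/
  galG : Gal → GB → GB
  /-- «`γ_H` is a semi-simple element of `H`» [§3.1 p. 377] -/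
  IsSSH : HB → Prop
  /-- «semi-simple conjugacy classes in `G`»: semi-simple elements of `G` [§3.1 p. 378] -/
  IsSSG : GB → Prop
  /-- conjugacy in `H` (over `F̄`) [§3.1 p. 378 «semi-simple conjugacy classes in `H`»] -/
  IsConjH : HB → HB → Prop
  /-- conjugacy in `G` (over `F̄`) [§3.1 p. 377 «The conjugacy class of `γ`»] -/
  IsConjG : GB → GB → Prop
  /-- «`γ_H ∈ H(F)`» [§3.1 p. 378] -/
  IsRatH : HB → Prop
  /-- «`γ ∈ G(F)`» [§3.1 p. 378] -/
  IsRatG : GB → Prop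
  /-- the maximal tori `T_H` of `H` (over `F̄`) [§3.1 p. 377] -/
  TorH : Type u
  /-- «a maximal torus `T_H` of `H` containing `γ_H`»: membership `γ_H ∈ T_H` [§3.1 p. 377] -/
  Mem : HB → TorH → Prop
  /-- the character lattice `X^*(T_H) = X^*(T)` («use `j` to identify `T_H`, `T`»; `R_H ⊂ R ⊂ X^*(T)`) [§3.1 p. 378] -/
  X : TorH → Type u
  /-- `R`, «the set of roots of `T` in `G`», `T = j(T_H)`, as a subset of `X^*(T_H)` [§3.1 p. 378] -/
  rootsG : (T : TorH) → Set (X T)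
  /-- `R_H`, «the set of roots of `T` in `H`» [§3.1 p. 378] -/
  rootsH : (T : TorH) → Set (X T)
  /-- the evaluation `α ↦ α(γ_H) ∈ F̄ˣ` of characters of `T_H` at `γ_H ∈ T_H` [§3.1 p. 378 «`α(γ_H) ≠ 1`»] -/
  ev : {γ : HB} → {T : TorH} → Mem γ T → X T → Fbarˣ
  /-- the members `j : T_H → G` of «a canonical `G`-conjugacy class of embeddings» [§3.1 p. 377] -/
  Emb : TorH → Type u
  /-- `γ = j(γ_H) ∈ G(F̄)` for `γ_H ∈ T_H` [§3.1 p. 377] -/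
  j : {T : TorH} → Emb T → {γ : HB} → Mem γ T → GB
  /-- «the centralizer of `γ` in `G` is connected» [Lemma 3.2 p. 378] -/
  CentConnG : GB → Prop
  /-- «the centralizer of `γ_H` in `H` is connected» [Lemma 3.2 p. 378] -/
  CentConnH : HB → Prop
  /-- the isomorphisms `j₁ : I_H → I` (over `F̄`) between the connected centralizers `I_H` of `γ_H` and `I` of `γ` [§3.1 p. 378] -/
  IsoCent : HB → GB → Type u
  /-- «`j : T_H ⥲ T` extends to an isomorphism `j₁ : I_H → I`»: `j₁` extends `j` [§3.1 p. 378] -/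
  Extends : {T : TorH} → {γ : HB} → (h : Mem γ T) → (e : Emb T) → IsoCent γ (j e h) → Prop
  /-- two isomorphisms `I_H → I` differ by an «inner automorphism coming from `T`» [§3.1 p. 378] -/
  InnerT : {γH : HB} → {γ : GB} → IsoCent γH γ → IsoCent γH γ → Prop
  /-- «`j₁` is an inner twisting» (`I_H`, `I` defined over `F`) [§3.1 p. 378] -/
  IsInnerTwisting : {γH : HB} → {γ : GB} → IsoCent γH γ → Prop
  /-- `Z(Î_H)`, the centre of the dual group of `I_H` [§3.1 p. 378] -/
  ZIH : HB → Type u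
  /-- `Z(Î)`, the centre of the dual group of `I` [§3.1 p. 378] -/
  ZI : GB → Type u
  /-- the map `Z(Î_H) → Z(Î)` induced by an isomorphism `j₁ : I_H → I` [§3.1 p. 378 «`Z(Î_H) = Z(Î)`»] -/
  zTransport : {γH : HB} → {γ : GB} → IsoCent γH γ → ZIH γH → ZI γ

namespace EndoscopicDatum

variable {Fbar : Type u} [Field Fbar] (D : EndoscopicDatum Fbar)

/-- «Let `γ_H` be a semi-simple element of `H`. Choose a maximal torus `T_H` of `H` containing `γ_H`» — every semi-simple
element lies in a maximal torus. [cite: Kottwitz1986, §3.1 (p. 377)] -/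
def SemisimpleInTorus : Prop :=
  ∀ γH : D.HB, D.IsSSH γH → ∃ T : D.TorH, D.Mem γH T

/-- «There is a canonical `G`-conjugacy class of embeddings `j : T_H → G`; choose one» — the class is non-empty.
[cite: Kottwitz1986, §3.1 (p. 377)] -/
def EmbNonempty : Prop :=
  ∀ T : D.TorH, Nonempty (D.Emb T)

/-- «We have `R_H ⊂ R ⊂ X^*(T)`.» [cite: Kottwitz1986, §3.1 (p. 378)] -/
def RootsNested : Prop :=
  ∀ T : D.TorH, D.rootsH T ⊆ D.rootsG T

/-- `γ_H ∈ T_H` is `(G, H)`-regular, computed in the torus `T_H` (the printed definition, through `IsGHRegular`).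
[cite: Kottwitz1986, §3.1 (p. 378)] -/
def IsGHRegularAt (γH : D.HB) {T : D.TorH} (h : D.Mem γH T) : Prop :=
  IsGHRegular (D.rootsG T) (D.rootsH T) (D.ev h)

/-- `γ_H ∈ T_H` is `G`-regular, computed in `T_H` (through `IsGRegular`). [cite: Kottwitz1986, §3.1 (p. 378), §5.4 (p. 380)] -/
def IsGRegularAt (γH : D.HB) {T : D.TorH} (h : D.Mem γH T) : Prop :=
  IsGRegular (D.rootsG T) (D.ev h)

/-- **3.1** «The conjugacy class of `γ` is independent of the choice of `T_H` and `j`.» [cite: Kottwitz1986, §3.1 (p. 377)] -/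
def Kottwitz1986_3_1_imageWellDefined : Prop :=
  ∀ (γH : D.HB) (T T' : D.TorH) (h : D.Mem γH T) (h' : D.Mem γH T') (e : D.Emb T) (e' : D.Emb T'),
    D.IsSSH γH → D.IsConjG (D.j e h) (D.j e' h')

/-- **3.1** «thus `γ_H ↦ γ` induces a `Γ`-equivariant map from the set of semi-simple conjugacy classes in `H` to the set of
semi-simple conjugacy classes in `G`»: the image of a semi-simple element is semi-simple, conjugate elements have conjugate
images, and the image of `σ(γ_H)` is conjugate to `σ` of the image of `γ_H`. [cite: Kottwitz1986, §3.1 (pp. 377–378)] -/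
def Kottwitz1986_3_1_classMap : Prop :=
  (∀ (γH : D.HB) (T : D.TorH) (h : D.Mem γH T) (e : D.Emb T), D.IsSSH γH → D.IsSSG (D.j e h)) ∧
  (∀ (γH γH' : D.HB) (T T' : D.TorH) (h : D.Mem γH T) (h' : D.Mem γH' T') (e : D.Emb T) (e' : D.Emb T'),
    D.IsSSH γH → D.IsSSH γH' → D.IsConjH γH γH' → D.IsConjG (D.j e h) (D.j e' h')) ∧
  ∀ (σ : D.Gal) (γH : D.HB) (T T' : D.TorH) (h : D.Mem γH T) (hσ : D.Mem (D.galH σ γH) T') (e : D.Emb T)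
    (e' : D.Emb T'), D.IsSSH γH → D.IsConjG (D.j e' hσ) (D.galG σ (D.j e h))

/-- **3.1** «The `(G, H)`-regularity of `γ_H` depends only on `γ_H`, not on the choice of `T_H` and `j`.»
[cite: Kottwitz1986, §3.1 (p. 378)] -/
def Kottwitz1986_3_1_regularWellDefined : Prop :=
  ∀ (γH : D.HB) (T T' : D.TorH) (h : D.Mem γH T) (h' : D.Mem γH T'),
    D.IsSSH γH → (D.IsGHRegularAt γH h ↔ D.IsGHRegularAt γH h')

/-- «`γ_H` is a `(G, H)`-regular semi-simple element» as a predicate on `H(F̄)` (in every maximal torus containing it; by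
`Kottwitz1986_3_1_regularWellDefined` the choice is immaterial). [cite: Kottwitz1986, §3.1 (p. 378)] -/
def IsGHRegularElem (γH : D.HB) : Prop :=
  D.IsSSH γH ∧ ∀ (T : D.TorH) (h : D.Mem γH T), D.IsGHRegularAt γH h

/-- **3.1** «Now assume that `γ_H` is `(G, H)`-regular. … The theory of root data for reductive groups shows that `j : T_H ⥲ T`
extends to an isomorphism `j₁ : I_H → I`, unique up to inner automorphisms coming from `T`.» [cite: Kottwitz1986, §3.1 (p. 378)] -/
def Kottwitz1986_3_1_centralizerIso : Prop :=
  ∀ (γH : D.HB) (T : D.TorH) (h : D.Mem γH T) (e : D.Emb T), D.IsSSH γH → D.IsGHRegularAt γH h →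
    (∃ ι : D.IsoCent γH (D.j e h), D.Extends h e ι) ∧
    ∀ ι ι' : D.IsoCent γH (D.j e h), D.Extends h e ι → D.Extends h e ι' → D.InnerT ι ι'

/-- **3.1** «If `γ_H ∈ H(F)` and `γ ∈ G(F)`, then `I_H`, `I` are defined over `F` and `j₁` is an inner twisting. In particular
we have `Z(Î_H) = Z(Î)`» — every `j₁` extending `j` is an inner twisting, transports `Z(Î_H)` bijectively onto `Z(Î)`, and the
transported map does not depend on the choice of `j₁` (a canonical identification). [cite: Kottwitz1986, §3.1 (p. 378)] -/
def Kottwitz1986_3_1_innerTwisting : Prop :=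
  ∀ (γH : D.HB) (T : D.TorH) (h : D.Mem γH T) (e : D.Emb T), D.IsSSH γH → D.IsGHRegularAt γH h →
    D.IsRatH γH → D.IsRatG (D.j e h) → ∀ ι : D.IsoCent γH (D.j e h), D.Extends h e ι →
      D.IsInnerTwisting ι ∧ Function.Bijective (D.zTransport ι) ∧
        ∀ ι' : D.IsoCent γH (D.j e h), D.Extends h e ι' → D.zTransport ι' = D.zTransport ι

/-- **3.2. Lemma** (p. 378): «Let `γ_H, γ` be as above and assume that `γ_H` is `(G, H)`-regular. If the centralizer of `γ` in
`G` is connected, then so is the centralizer of `γ_H` in `H`.» [cite: Kottwitz1986, Lemma 3.2 (p. 378)] -/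
def Kottwitz1986_3_2 : Prop :=
  ∀ (γH : D.HB) (T : D.TorH) (h : D.Mem γH T) (e : D.Emb T), D.IsSSH γH → D.IsGHRegularAt γH h →
    D.CentConnG (D.j e h) → D.CentConnH γH

/-- The printed laws of §3 together. [cite: Kottwitz1986, §3 (pp. 377–378)] -/
def PrintedLaws3 : Prop :=
  D.SemisimpleInTorus ∧ D.EmbNonempty ∧ D.RootsNested ∧ D.Kottwitz1986_3_1_imageWellDefined ∧
    D.Kottwitz1986_3_1_classMap ∧ D.Kottwitz1986_3_1_regularWellDefined ∧ D.Kottwitz1986_3_1_centralizerIso ∧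
    D.Kottwitz1986_3_1_innerTwisting ∧ D.Kottwitz1986_3_2

end EndoscopicDatum

/-! ## §3 The data of §4 for a LOCAL field, over the §1 datum `LocalCohomology.LocalDatum`; 4.1–4.4, 4.6 as relations -/

/-- **The data of Kottwitz's §4 AS A DATUM, `F` local**, over the §1 datum `L` (which supplies the connected reductive `F`-groups
`L.Grp`, the pointed sets `H¹(F, G) = L.H1 G` with base points `L.base G`, the groups `A(G) = L.A G` with `L.oneA`, `L.mulA`, the
maps `α_G = L.alpha G` of Theorem 1.2, and «`F` is `p`-adic» `L.IsPadic`).  Fields: `G(F)`; «semi-simple»; `I = (G_γ)⁰` as an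
object of `L.Grp`; «`G_γ` is connected»; stable conjugacy and `G(F)`-conjugacy; `H¹(F, I) → H¹(F, G)` induced by `I ⊂ G` («not a
normal homomorphism», p. 379, hence not an `L.Hom`); the class in `H¹(F, I)` of the torsor `{g ∈ G(F̄) | gγg⁻¹ = γ′}` (4.1);
`Z(Ĝ)` with its `Γ`-action and the injection `Z(Ĝ) → Z(Î)` (4.2); `A(I) → A(G)` induced by it (4.3); `π₀([Z(Î)/Z(Ĝ)]^Γ)`,
`H¹(F, Z(Ĝ))` with its trivial class and the map between them [K3, Cor. 2.3] (4.6); the duality pairing `⟨·, ·⟩` on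
`A(I) × π₀([Z(Î)/Z(Ĝ)]^Γ)` restricting to the pairing of `𝔈(I/F)` with `𝔎(I/F)` (4.6, p. 381).  No field asserts a printed
statement. [cite: Kottwitz1986, §4 (pp. 378–379)] -/
structure LocalSignsDatum (L : LocalCohomology.LocalDatum.{u}) : Type (u + 1) where
  /-- `G(F)` [§4 p. 378 «a semi-simple element of `G(F)`»] -/
  GF : L.Grp → Type u
  /-- «`γ` is a semi-simple element of `G(F)`» [§4 p. 378] -/
  IsSS : {G : L.Grp} → GF G → Prop
  /-- `I`, «the identity component of `G_γ`», as a connected reductive `F`-group [§4 p. 378] -/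
  cent : {G : L.Grp} → GF G → L.Grp
  /-- «`G_γ` is connected» [§4.1 p. 378] -/
  CentConn : {G : L.Grp} → GF G → Prop
  /-- «`γ′ ∈ G(F)` is a stable conjugate of `γ`» [§4.1 p. 378] -/
  IsStConj : {G : L.Grp} → GF G → GF G → Prop
  /-- conjugacy under `G(F)` («the conjugacy classes in the stable conjugacy class of `γ`») [§4.1 p. 378] -/
  IsConjF : {G : L.Grp} → GF G → GF G → Prop
  /-- `H¹(F, I) → H¹(F, G)` induced by the inclusion `I ⊂ G` [§4.1 p. 378; p. 379 «not a normal homomorphism»] -/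
  incH1 : {G : L.Grp} → (γ : GF G) → L.H1 (cent γ) → L.H1 G
  /-- the class in `H¹(F, I)` of the `F`-torsor `{g ∈ G(F̄) | gγg⁻¹ = γ′}` under `I`, `γ′` a stable conjugate of `γ` [§4.1 p. 378] -/
  invD : {G : L.Grp} → (γ γ' : GF G) → IsStConj γ γ' → L.H1 (cent γ)
  /-- `Γ = Gal(F̄/F)` [p. 368; §4.2 p. 378 «`Γ`-equivariant»] -/
  Gal : Type u
  /-- `Z(Ĝ)`, the centre of the dual group (for `I = cent γ` this is `Z(Î)`) [§4.2 p. 378] -/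
  Zhat : L.Grp → Type u
  /-- the action of `Γ` on `Z(Ĝ)` [§4.2 p. 378] -/
  galZ : {G : L.Grp} → Gal → Zhat G → Zhat G
  /-- the canonical injection `Z(Ĝ) → Z(Î)` of 4.2 (both regarded inside `T̂`, `T` a maximal `F`-torus of `I`) [§4.2 p. 378] -/
  zInc : {G : L.Grp} → (γ : GF G) → Zhat G → Zhat (cent γ)
  /-- `A(I) → A(G)`, «induced by the injection `Z(Ĝ) → Z(Î)` of 4.2» [Lemma 4.3 p. 378] -/
  incA : {G : L.Grp} → (γ : GF G) → L.A (cent γ) → L.A G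
  /-- `π₀([Z(Î)/Z(Ĝ)]^Γ)` [§4.6 p. 379] -/
  PiZ : {G : L.Grp} → GF G → Type u
  /-- `H¹(F, Z(Ĝ))` [§4.6 p. 379] -/
  H1Z : L.Grp → Type u
  /-- the trivial class of `H¹(F, Z(Ĝ))` [§4.6 (a) p. 379 «trivial»] -/
  baseH1Z : (G : L.Grp) → H1Z G
  /-- the homomorphism `π₀([Z(Î)/Z(Ĝ)]^Γ) → H¹(F, Z(Ĝ))` of [K3, Corollary 2.3] [§4.6 p. 379] -/
  bd : {G : L.Grp} → (γ : GF G) → PiZ γ → H1Z G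
  /-- the duality pairing `⟨·, ·⟩` (values in `ℂ`) of `A(I) = π₀(Z(Î)^Γ)^D`-elements against `π₀([Z(Î)/Z(Ĝ)]^Γ)`, whose
  restriction is «the duality pairing between `𝔈(I/F)` and `𝔎(I/F)` (see 4.6)» [§4.6 p. 379; §5.6 p. 381] -/
  pair : {G : L.Grp} → (γ : GF G) → L.A (cent γ) → PiZ γ → ℂ

namespace LocalSignsDatum

variable {L : LocalCohomology.LocalDatum.{u}} (D : LocalSignsDatum L)

/-- **4.1** «We define `𝔇(I/F)` to be `ker[H¹(F, I) → H¹(F, G)]`» (kernel of a map of pointed sets = fibre of the base point),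
for `I = (G_γ)⁰`. [cite: Kottwitz1986, §4.1 (p. 378)] -/
def frakD {G : L.Grp} (γ : D.GF G) : Set (L.H1 (D.cent γ)) :=
  {x | D.incH1 γ x = L.base G}

/-- **4.1** «If `G_γ` is connected, then `𝔇(I/F)` is in 1–1 correspondence with the conjugacy classes in the stable conjugacy
class of `γ`», through `γ′ ↦` the class of the torsor `{g ∈ G(F̄) | gγg⁻¹ = γ′}`. [cite: Kottwitz1986, §4.1 (p. 378)] -/
def Kottwitz1986_4_1 : Prop :=
  ∀ (G : L.Grp) (γ : D.GF G), D.IsSS γ → D.CentConn γ →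
    IsTorsorClassification (S := {γ' : D.GF G // D.IsStConj γ γ'}) (D.incH1 γ) (L.base G)
      (fun s s' => D.IsConjF s.1 s'.1) (fun s => D.invD γ s.1 s.2)

/-- **4.2** «There is a canonical `Γ`-equivariant injection of `Z(Ĝ)` into `Z(Î)` … this injection does not depend on the
choice of `T`» — the posited `zInc γ` is injective and `Γ`-equivariant. [cite: Kottwitz1986, §4.2 (p. 378)] -/
def Kottwitz1986_4_2 : Prop :=
  ∀ (G : L.Grp) (γ : D.GF G), D.IsSS γ →
    Function.Injective (D.zInc γ) ∧ ∀ (σ : D.Gal) (z : D.Zhat G), D.zInc γ (D.galZ σ z) = D.galZ σ (D.zInc γ z)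

/-- **4.3. Lemma** (p. 378, `F` local): «the diagram `H¹(F, I) → H¹(F, G)` ∕ `A(I) → A(G)` commutes, where the bottom arrow is
induced by the injection `Z(Ĝ) → Z(Î)` of 4.2» — with the vertical maps `α_I`, `α_G` of Theorem 1.2 (`L.alpha`).
[cite: Kottwitz1986, Lemma 4.3 (p. 378)] -/
def Kottwitz1986_4_3 : Prop :=
  ∀ (G : L.Grp) (γ : D.GF G), D.IsSS γ →
    ∀ x : L.H1 (D.cent γ), L.alpha G (D.incH1 γ x) = D.incA γ (L.alpha (D.cent γ) x)

/-- **4.4** «We define `𝔈(I/F)` to be the finite abelian group `ker[A(I) → A(G)]`» (`F` local), for `I = (G_γ)⁰`.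
[cite: Kottwitz1986, §4.4 (p. 379)] -/
def frakE {G : L.Grp} (γ : D.GF G) : Set (L.A (D.cent γ)) :=
  {a | D.incA γ a = L.oneA G}

/-- **4.4** the map `𝔇(I/F) → A(I)` given by `α_I` — by Lemma 4.3 it lands in `𝔈(I/F)` («Lemma 4.3 gives us a canonical map
`𝔇(I/F) → 𝔈(I/F)`», the relation `Kottwitz1986_4_4`). [cite: Kottwitz1986, §4.4 (p. 379)] -/
def dToE {G : L.Grp} (γ : D.GF G) (x : D.frakD γ) : L.A (D.cent γ) :=
  L.alpha (D.cent γ) x.1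

/-- **4.4** (`F` local): «`𝔈(I/F)` [is] the finite abelian group `ker[A(I) → A(G)]` … Lemma 4.3 gives us a canonical map
`𝔇(I/F) → 𝔈(I/F)`, which is bijective in the `p`-adic case.» — `A(I) → A(G)` (induced by `Z(Ĝ) → Z(Î)`) respects unit and product, so
that `𝔈(I/F)` is a subgroup (ED. 2, squad QA T-ref5 «QA-11» NB-1), it is finite, `α_I` maps `𝔇(I/F)` into it (Lemma 4.3), bijectively if `F`
is `p`-adic. [cite: Kottwitz1986, §4.4 (p. 379)] -/
def Kottwitz1986_4_4 : Prop :=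
  ∀ (G : L.Grp) (γ : D.GF G), D.IsSS γ →
    (D.incA γ (L.oneA (D.cent γ)) = L.oneA G ∧
      ∀ a b : L.A (D.cent γ), D.incA γ (L.mulA a b) = L.mulA (D.incA γ a) (D.incA γ b)) ∧
    (D.frakE γ).Finite ∧ Set.MapsTo (L.alpha (D.cent γ)) (D.frakD γ) (D.frakE γ) ∧
      (L.IsPadic → Set.BijOn (L.alpha (D.cent γ)) (D.frakD γ) (D.frakE γ))

/-- **4.6 (a)** (`F` local): «We define `𝔎(I/F)` to be the subgroup of `π₀([Z(Î)/Z(Ĝ)]^Γ)` consisting of all elements whose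
image in `H¹(F, Z(Ĝ))` is trivial». [cite: Kottwitz1986, §4.6 (p. 379)] -/
def frakK {G : L.Grp} (γ : D.GF G) : Set (D.PiZ γ) :=
  {x | D.bd γ x = D.baseH1Z G}

/-- **4.6** (`F` local): «If `F` is local, then `𝔎(I/F) = cok[A(G)^D → A(I)^D] = 𝔈(I/F)^D`» — typed as: the pairing `⟨·, ·⟩`
restricted to `𝔈(I/F) × 𝔎(I/F)` is perfect (separating in both variables), multiplicative in `𝔈(I/F)` (for the product of
`A(I)`), and every character of `𝔈(I/F)` is `⟨·, κ⟩` for some `κ ∈ 𝔎(I/F)`; the intermediate identification with the cokernel of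
`A(G)^D = π₀(Z(Ĝ)^Γ) → π₀(Z(Î)^Γ) = A(I)^D` is the exactness of [K3, Corollary 2.3] behind it.  The pairing is typed `ℂ`-valued and
multiplicative in the `𝔈(I/F)`-variable only; multiplicativity in `κ` would need the group law of `π₀([Z(Î)/Z(Ĝ)]^Γ)`, which is not
posited here (squad QA T-ref5 «QA-11» NB-2, ED. 2). [cite: Kottwitz1986, §4.6 (p. 379)] -/
def Kottwitz1986_4_6_local : Prop :=
  ∀ (G : L.Grp) (γ : D.GF G), D.IsSS γ →
    (∀ κ ∈ D.frakK γ, ∀ κ' ∈ D.frakK γ, (∀ e ∈ D.frakE γ, D.pair γ e κ = D.pair γ e κ') → κ = κ') ∧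
    (∀ e ∈ D.frakE γ, ∀ e' ∈ D.frakE γ, (∀ κ ∈ D.frakK γ, D.pair γ e κ = D.pair γ e' κ) → e = e') ∧
    (∀ κ ∈ D.frakK γ, D.pair γ (L.oneA (D.cent γ)) κ = 1 ∧
      ∀ e ∈ D.frakE γ, ∀ e' ∈ D.frakE γ, D.pair γ (L.mulA e e') κ = D.pair γ e κ * D.pair γ e' κ) ∧
    ∀ χ : L.A (D.cent γ) → ℂ, χ (L.oneA (D.cent γ)) = 1 →
      (∀ e ∈ D.frakE γ, ∀ e' ∈ D.frakE γ, χ (L.mulA e e') = χ e * χ e') →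
        ∃ κ ∈ D.frakK γ, ∀ e ∈ D.frakE γ, χ e = D.pair γ e κ

/-- The printed laws of §4, local case, together. [cite: Kottwitz1986, §4 (pp. 378–379)] -/
def PrintedLaws4Local : Prop :=
  D.Kottwitz1986_4_1 ∧ D.Kottwitz1986_4_2 ∧ D.Kottwitz1986_4_3 ∧ D.Kottwitz1986_4_4 ∧ D.Kottwitz1986_4_6_local

end LocalSignsDatum

/-! ## §4 The data of §4 for a GLOBAL field, over the §2 datum `GlobalCohomology.GlobalDatum`; 4.1, 4.5, 4.6 (b) -/

/-- **The data of Kottwitz's §4 AS A DATUM, `F` global** (a number field), over the §2 datum `M` (which supplies `M.Grp`, the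
pointed sets `H¹(F, G) = M.H1F G` and the places `M.Pl`).  Fields: `G(F)`, «semi-simple», `I = (G_γ)⁰`, «`G_γ` connected», stable
and `G(F)`-conjugacy, the base point of `H¹(F, G)`, `H¹(F, I) → H¹(F, G)` and the torsor classes of 4.1; the local groups
`𝔈(I/F_v)` of 4.4 with their units (4.5); `π₀([Z(Î)/Z(Ĝ)]^Γ) → H¹(F, Z(Ĝ))` [K3, Cor. 2.3] and the localisation maps
`H¹(F, Z(Ĝ)) → H¹(F_v, Z(Ĝ))` with the local trivial classes (4.6 (b) «locally trivial»).  No field asserts a printed statement.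
[cite: Kottwitz1986, §4 (pp. 378–379)] -/
structure GlobalSignsDatum (M : GlobalCohomology.GlobalDatum.{u}) : Type (u + 1) where
  /-- `G(F)` [§4 p. 378] -/
  GF : M.Grp → Type u
  /-- «`γ` is a semi-simple element of `G(F)`» [§4 p. 378] -/
  IsSS : {G : M.Grp} → GF G → Prop
  /-- `I`, «the identity component of `G_γ`» [§4 p. 378] -/
  cent : {G : M.Grp} → GF G → M.Grp
  /-- «`G_γ` is connected» [§4.1 p. 378] -/
  CentConn : {G : M.Grp} → GF G → Prop
  /-- «`γ′ ∈ G(F)` is a stable conjugate of `γ`» [§4.1 p. 378] -/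
  IsStConj : {G : M.Grp} → GF G → GF G → Prop
  /-- conjugacy under `G(F)` [§4.1 p. 378] -/
  IsConjF : {G : M.Grp} → GF G → GF G → Prop
  /-- the base point (trivial class) of `H¹(F, G) = M.H1F G` [§4.1 p. 378 «`ker`»] -/
  baseF : (G : M.Grp) → M.H1F G
  /-- `H¹(F, I) → H¹(F, G)` induced by `I ⊂ G` [§4.1 p. 378] -/
  incH1 : {G : M.Grp} → (γ : GF G) → M.H1F (cent γ) → M.H1F G
  /-- the class in `H¹(F, I)` of the torsor `{g ∈ G(F̄) | gγg⁻¹ = γ′}` [§4.1 p. 378] -/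
  invD : {G : M.Grp} → (γ γ' : GF G) → IsStConj γ γ' → M.H1F (cent γ)
  /-- the local groups `𝔈(I/F_v) = ker[A(I_v) → A(G_v)]` of 4.4 at the places `v` [§4.5 p. 379] -/
  Eloc : {G : M.Grp} → GF G → M.Pl → Type u
  /-- the unit of `𝔈(I/F_v)` [§4.5 p. 379 «`⊕_v`»] -/
  oneEloc : {G : M.Grp} → {γ : GF G} → (v : M.Pl) → Eloc γ v
  /-- `π₀([Z(Î)/Z(Ĝ)]^Γ)` [§4.6 p. 379] -/
  PiZ : {G : M.Grp} → GF G → Type u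
  /-- `H¹(F, Z(Ĝ))` [§4.6 p. 379] -/
  H1Z : M.Grp → Type u
  /-- `π₀([Z(Î)/Z(Ĝ)]^Γ) → H¹(F, Z(Ĝ))` [K3, Corollary 2.3] [§4.6 p. 379] -/
  bd : {G : M.Grp} → (γ : GF G) → PiZ γ → H1Z G
  /-- `H¹(F_v, Z(Ĝ))` at a place `v` [§4.6 (b) p. 379 «locally trivial»] -/
  H1Zloc : M.Grp → M.Pl → Type u
  /-- the trivial class of `H¹(F_v, Z(Ĝ))` [§4.6 (b) p. 379] -/
  baseH1Zloc : {G : M.Grp} → (v : M.Pl) → H1Zloc G v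
  /-- the localisation `H¹(F, Z(Ĝ)) → H¹(F_v, Z(Ĝ))` [§4.6 (b) p. 379] -/
  res : {G : M.Grp} → H1Z G → (v : M.Pl) → H1Zloc G v

namespace GlobalSignsDatum

variable {M : GlobalCohomology.GlobalDatum.{u}} (D : GlobalSignsDatum M)

/-- **4.1** (`F` global) «`𝔇(I/F) = ker[H¹(F, I) → H¹(F, G)]`». [cite: Kottwitz1986, §4.1 (p. 378)] -/
def frakD {G : M.Grp} (γ : D.GF G) : Set (M.H1F (D.cent γ)) :=
  {x | D.incH1 γ x = D.baseF G}

/-- **4.1** (`F` global) «If `G_γ` is connected, then `𝔇(I/F)` is in 1–1 correspondence with the conjugacy classes in the stable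
conjugacy class of `γ`.» [cite: Kottwitz1986, §4.1 (p. 378)] -/
def Kottwitz1986_4_1 : Prop :=
  ∀ (G : M.Grp) (γ : D.GF G), D.IsSS γ → D.CentConn γ →
    IsTorsorClassification (S := {γ' : D.GF G // D.IsStConj γ γ'}) (D.incH1 γ) (D.baseF G)
      (fun s s' => D.IsConjF s.1 s'.1) (fun s => D.invD γ s.1 s.2)

/-- **4.5** (`F` global) «We define `𝔈(I/𝔸)` to be `⊕_v 𝔈(I/F_v)`, where `v` runs through the set of places of `F`» — the
finitely supported families. [cite: Kottwitz1986, §4.5 (p. 379)] -/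
def frakEA {G : M.Grp} (γ : D.GF G) : Set ((v : M.Pl) → D.Eloc γ v) :=
  {e | {v : M.Pl | e v ≠ D.oneEloc v}.Finite}

/-- **4.6 (b)** (`F` global) «`𝔎(I/F)` [is] the subgroup of `π₀([Z(Î)/Z(Ĝ)]^Γ)` consisting of all elements whose image in
`H¹(F, Z(Ĝ))` is locally trivial». [cite: Kottwitz1986, §4.6 (p. 379)] -/
def frakK {G : M.Grp} (γ : D.GF G) : Set (D.PiZ γ) :=
  {x | ∀ v : M.Pl, D.res (D.bd γ x) v = D.baseH1Zloc v}

end GlobalSignsDatum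

end Literature.NumberTheory.Kottwitz1986.RegularAndSigns
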